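import Literature.Combinatorics.StablePolynomials.SymmetrizationExteriorDisk
import HarnessLib

/-!
# Exteriors of arbitrary discs: the affine transport (Borcea–Brändén I, Lemma 6.1 and II, Theorem 1.2 (b),
# Proposition 1.3 (b) for `C = {|z - c| > r}`)

J. Borcea, P. Brändén, *The Lee–Yang and Pólya–Schur programs. I.*, Invent. Math. 177 (2009) 541–569
(arXiv:0809.0401), §6.1, proof of Lemma 6.1: "We may assume that `C_j` is the exterior of the closed unit
disk `𝔻̄` for all `j ∈ [n]`"; part II (Comm. Pure Appl. Math. 62 (2009) 1595–1631, arXiv:0809.3087), §1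
Lemma 1.8 and the proof of Theorem 1.2 / Proposition 1.3: the change of variables `Φ_κ` (here the affine
substitution `z_i ↦ r z_i + c`, the tree's `affineSubst r c`) "commutes with the partial symmetrization
operator".

This file performs that reduction for the exterior `{|z - c| > r}` (`r > 0`) of an arbitrary closed disc,
the general *open non-convex circular domain*: the affine substitution does not raise partial degrees
(`degreeOf_affineSubst_le`), is invertible (`affineSubst_affineSubst`, hence `degreeOf_affineSubst`,
`degVec_affineSubst`), multiplies the top coefficient `a(κ)`, `κ = degVec f`, by `r^{|κ|}`
(`coeff_degVec_affineSubst`), and exchanges `{|z - c| > r}ⁿ`-stability with `(ℂ ∖ 𝔻̄)ⁿ`-stability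
(`exteriorDiskStable_affineSubst`, `eval_ne_zero_of_exteriorDiskStable_affineSubst`). Consequences:
part I Lemma 6.1 (`J = [n]`) and part II Theorem 1.2 (b), Proposition 1.3 (b) for every open non-convex
circular domain, from the unit case (`ExteriorDiskSupport.lean`, `SymmetrizationExteriorDisk.lean`).

## Main results (namespace `Literature.Combinatorics.StablePolynomials`)

* `degreeOf_affineSubst_le`, `affineSubst_affineSubst`, `affineSubst_one_zero`, `degreeOf_affineSubst`,
  `degVec_affineSubst`; `coeff_top_prod_C_mul_X_add_C_pow`, `coeff_degVec_affineSubst`.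
* `exteriorDiskStable_affineSubst`, `eval_ne_zero_of_exteriorDiskStable_affineSubst`.
* **`BorceaBranden_exteriorBall_support`** — part I Lemma 6.1 (`J = [n]`) for `C_i = {|z - c| > r}`.
* **`symmetrization_exteriorBallStable`**, **`partialSymmetrization_exteriorBallStable`** — part II
  Thm. 1.2 (b), Prop. 1.3 (b) for `C = {|z - c| > r}`.

## References

* [BorceaBranden2009] J. Borcea, P. Brändén, Invent. Math. 177 (2009) 541–569, §6.1 Lemma 6.1.
* [BorceaBranden2009II] J. Borcea, P. Brändén, Comm. Pure Appl. Math. 62 (2009) 1595–1631, §1 Thm. 1.2 (b),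
  Prop. 1.3 (b), Lemma 1.8.
-/

noncomputable section

open MvPolynomial Finset

namespace Literature.Combinatorics.StablePolynomials

variable {σ : Type*} [Fintype σ] [DecidableEq σ]

/-! ## §1 The affine substitution: degrees, inverse, top coefficient -/

section Affine

omit [Fintype σ] in
/-- `deg_{z_i} f(az + b) ≤ deg_{z_i} f`. [cite: BorceaBranden2009II, §1 Lemma 1.8 (`Φ_κ : ℂ_κ[z] → ℂ_κ[z]`)] -/
theorem degreeOf_affineSubst_le (a b : ℂ) (f : MvPolynomial σ ℂ) (i : σ) :
    degreeOf i (affineSubst a b f) ≤ degreeOf i f := by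
  conv_lhs => rw [f.as_sum]
  rw [map_sum]
  refine (degreeOf_sum_le i _ _).trans (Finset.sup_le fun m hm => ?_)
  rw [affineSubst, bind₁_monomial]
  refine (degreeOf_C_mul_le _ _ _).trans ((degreeOf_prod_le i _ _).trans ?_)
  calc ∑ j ∈ m.support, degreeOf i ((C a * X j + C b) ^ m j)
      ≤ ∑ j ∈ m.support, (if i = j then m j else 0) := Finset.sum_le_sum fun j _ =>
        (degreeOf_pow_le _ _ _).trans (by
          refine (Nat.mul_le_mul_left _ (degreeOf_C_mul_X_add_C_le a b i j)).trans ?_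
          split_ifs <;> simp)
    _ ≤ m i := by
        rw [Finset.sum_ite_eq]
        split_ifs
        · exact le_rfl
        · exact Nat.zero_le _
    _ ≤ degreeOf i f := monomial_le_degreeOf i hm

omit [Fintype σ] [DecidableEq σ] in
/-- Composition of affine substitutions. [cite: BorceaBranden2009II, §1 Lemma 1.8 ("the relation … is an
equivalence relation")] -/
theorem affineSubst_affineSubst (a b a' b' : ℂ) (f : MvPolynomial σ ℂ) :
    affineSubst a' b' (affineSubst a b f) = affineSubst (a * a') (a * b' + b) f := by
  refine MvPolynomial.funext fun z => ?_
  rw [eval_affineSubst, eval_affineSubst, eval_affineSubst,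
    show (fun i => a * (a' * z i + b') + b) = fun i => a * a' * z i + (a * b' + b) from
      funext fun i => by ring]

omit [Fintype σ] [DecidableEq σ] in
/-- The identity substitution. [cite: BorceaBranden2009II, §1 Lemma 1.8] -/
theorem affineSubst_one_zero (f : MvPolynomial σ ℂ) : affineSubst 1 0 f = f :=
  MvPolynomial.funext fun z => by rw [eval_affineSubst]; simp

omit [Fintype σ] in
/-- **`deg_{z_i} f(az + b) = deg_{z_i} f`** for `a ≠ 0`. [cite: BorceaBranden2009II, §1 Lemma 1.8
(`Φ_κ` is invertible on `ℂ_κ[z]`)] -/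
theorem degreeOf_affineSubst {a : ℂ} (ha : a ≠ 0) (b : ℂ) (f : MvPolynomial σ ℂ) (i : σ) :
    degreeOf i (affineSubst a b f) = degreeOf i f := by
  refine le_antisymm (degreeOf_affineSubst_le a b f i) ?_
  have h : f = affineSubst a⁻¹ (-(a⁻¹ * b)) (affineSubst a b f) := by
    rw [affineSubst_affineSubst, mul_inv_cancel₀ ha, show a * -(a⁻¹ * b) + b = 0 by field_simp; ring,
      affineSubst_one_zero]
  conv_lhs => rw [h]
  exact degreeOf_affineSubst_le _ _ _ _

/-- `degVec f(az + b) = degVec f` for `a ≠ 0`. [cite: BorceaBranden2009, §6.1 proof of Lemma 6.1 ("we may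
assume that `C_j` is the exterior of the closed unit disk")] -/
theorem degVec_affineSubst {a : ℂ} (ha : a ≠ 0) (b : ℂ) (f : MvPolynomial σ ℂ) :
    degVec (affineSubst a b f) = degVec f := by
  ext i
  rw [degVec_apply, degVec_apply, degreeOf_affineSubst ha]

omit [Fintype σ] in
/-- `∏_{j ∈ S} (a z_j + b)^{κ_j}` does not involve `z_i`, `i ∉ S`. [cite: BorceaBranden2009, §6.1] -/
theorem degreeOf_prod_C_mul_X_add_C_pow_eq_zero (a b : ℂ) (κ : σ → ℕ) {S : Finset σ} {i : σ}
    (hi : i ∉ S) : degreeOf i (∏ j ∈ S, (C a * X j + C b) ^ κ j : MvPolynomial σ ℂ) = 0 := by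
  refine Nat.eq_zero_of_le_zero ((degreeOf_prod_le i _ _).trans (Finset.sum_nonpos fun j hj => ?_))
  refine (degreeOf_pow_le _ _ _).trans ?_
  rw [Nat.le_zero, Nat.mul_eq_zero]
  right
  have h := degreeOf_C_mul_X_add_C_le a b i j
  rw [if_neg (fun hij : i = j => hi (hij ▸ hj))] at h
  exact Nat.eq_zero_of_le_zero h

omit [Fintype σ] in
/-- **Top coefficient of `∏_{j ∈ S} (a z_j + b)^{κ_j}`**: `[z^{κ|_S}] = a^{Σ_{j∈S} κ_j}`.
[cite: BorceaBranden2009, §6.1 proof of Lemma 6.1 (reduction to the unit disc)] -/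
theorem coeff_top_prod_C_mul_X_add_C_pow (a b : ℂ) (κ : σ → ℕ) (S : Finset σ) :
    coeff (∑ j ∈ S, Finsupp.single j (κ j)) (∏ j ∈ S, (C a * X j + C b) ^ κ j : MvPolynomial σ ℂ) =
      a ^ ∑ j ∈ S, κ j := by
  induction S using Finset.induction_on with
  | empty => rw [Finset.sum_empty, Finset.prod_empty, Finset.sum_empty, pow_zero, coeff_zero_one]
  | insert i S hi ih =>
    rw [Finset.sum_insert hi, Finset.prod_insert hi, Finset.sum_insert hi, add_pow, Finset.sum_mul,
      coeff_sum]
    have hT : ∀ l, (C a * X i) ^ l * C b ^ (κ i - l) * ((κ i).choose l : MvPolynomial σ ℂ) =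
        monomial (Finsupp.single i l) (a ^ l * b ^ (κ i - l) * ((κ i).choose l : ℂ)) := fun l => by
      rw [← C_mul_X_pow_eq_monomial, mul_pow, ← map_pow, ← map_pow, map_mul, map_mul, map_natCast]
      ring
    have hdeg := degreeOf_prod_C_mul_X_add_C_pow_eq_zero a b κ hi
    rw [Finset.sum_eq_single_of_mem (κ i) (Finset.mem_range.2 (Nat.lt_succ_self _)) fun l hl hne => by
      rw [hT, coeff_monomial_mul', if_pos (by
        intro j
        by_cases hji : j = i
        · subst hji
          rw [Finsupp.single_eq_same, Finsupp.add_apply, Finsupp.single_eq_same]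
          exact (Nat.le_of_lt_succ (Finset.mem_range.1 hl)).trans (Nat.le_add_right _ _)
        · rw [Finsupp.single_eq_of_ne hji]
          exact Nat.zero_le _)]
      refine mul_eq_zero_of_right _ (notMem_support_iff.1 fun hmem => ?_)
      have h := monomial_le_degreeOf i hmem
      rw [hdeg, Finsupp.tsub_apply, Finsupp.add_apply, Finsupp.single_eq_same, Finsupp.single_eq_same,
        Finsupp.finsetSum_apply, Finset.sum_eq_zero (fun j hj => Finsupp.single_eq_of_ne
          (fun hij : i = j => hi (hij ▸ hj))), add_zero, Nat.le_zero] at h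
      exact hne (Nat.le_antisymm (Nat.le_of_lt_succ (Finset.mem_range.1 hl)) (Nat.sub_eq_zero_iff_le.1 h)),
      hT, coeff_monomial_mul', if_pos (by
        intro j
        by_cases hji : j = i
        · subst hji
          rw [Finsupp.add_apply, Finsupp.single_eq_same]
          exact Nat.le_add_right _ _
        · rw [Finsupp.single_eq_of_ne hji]
          exact Nat.zero_le _),
      add_tsub_cancel_left, ih, Nat.sub_self, pow_zero, mul_one, Nat.choose_self, Nat.cast_one, mul_one,
      pow_add]

/-- **The top coefficient under the affine substitution**: `[z^κ] f(az + b) = a^{|κ|} [z^κ] f` for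
`κ = degVec f`. [cite: BorceaBranden2009, §6.1 proof of Lemma 6.1 (reduction to the unit disc)] -/
theorem coeff_degVec_affineSubst (a b : ℂ) (f : MvPolynomial σ ℂ) :
    coeff (degVec f) (affineSubst a b f) =
      a ^ (∑ j ∈ (degVec f).support, degVec f j) * coeff (degVec f) f := by
  set κ := degVec f with hκ
  conv_lhs => rw [f.as_sum, map_sum, coeff_sum]
  rw [Finset.sum_eq_single κ (fun m hm hmκ => ?_)
    (fun hκmem => by rw [notMem_support_iff.1 hκmem, monomial_zero, map_zero, coeff_zero])]
  · rw [affineSubst, bind₁_monomial, coeff_C_mul, mul_comm]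
    congr 1
    have h := coeff_top_prod_C_mul_X_add_C_pow a b ⇑κ κ.support
    rwa [show (∑ j ∈ κ.support, Finsupp.single j (κ j)) = κ from Finsupp.sum_single κ] at h
  · -- `m ≠ κ`, `m ≤ κ`: the term has too small a degree in some variable
    have hle : m ≤ κ := le_degVec (mem_support_iff.1 hm)
    obtain ⟨j, hj⟩ : ∃ j, m j < κ j := by
      by_contra h
      push Not at h
      exact hmκ (le_antisymm hle (Finsupp.le_def.2 h))
    have hdeg : degreeOf j (affineSubst a b (monomial m (coeff m f))) ≤ m j :=
      (degreeOf_affineSubst_le a b _ j).trans (by rw [degreeOf_monomial_eq _ _ (mem_support_iff.1 hm)])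
    exact notMem_support_iff.1 fun hmem => (not_le.2 hj) ((monomial_le_degreeOf j hmem).trans hdeg)

end Affine

/-! ## §2 `{|z - c| > r}ⁿ`-stability versus `(ℂ ∖ 𝔻̄)ⁿ`-stability -/

section Transport

omit [Fintype σ] [DecidableEq σ] in
/-- The pull-back `f(ru + c)` of a polynomial with no zeros in `{|z_i - c| > r}ⁿ` is `(ℂ ∖ 𝔻̄)ⁿ`-stable.
[cite: BorceaBranden2009, §6.1 proof of Lemma 6.1 ("we may assume that `C_j` is the exterior of the closed
unit disk")] -/
theorem exteriorDiskStable_affineSubst {f : MvPolynomial σ ℂ} (c : ℂ) {r : ℝ} (hr : 0 < r)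
    (hs : ∀ z : σ → ℂ, (∀ i, r < ‖z i - c‖) → eval z f ≠ 0) (u : σ → ℂ) (hu : ∀ i, 1 < ‖u i‖) :
    eval u (affineSubst r c f) ≠ 0 := by
  rw [eval_affineSubst]
  refine hs _ fun i => ?_
  rw [add_sub_cancel_right, norm_mul, Complex.norm_real, Real.norm_of_nonneg hr.le]
  calc r = r * 1 := (mul_one r).symm
    _ < r * ‖u i‖ := mul_lt_mul_of_pos_left (hu i) hr

omit [Fintype σ] [DecidableEq σ] in
/-- From the pull-back back to `{|z_i - c| > r}ⁿ`. [cite: BorceaBranden2009, §6.1 proof of Lemma 6.1] -/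
theorem eval_ne_zero_of_exteriorDiskStable_affineSubst {g : MvPolynomial σ ℂ} (c : ℂ) {r : ℝ} (hr : 0 < r)
    (hg : ∀ u : σ → ℂ, (∀ i, 1 < ‖u i‖) → eval u (affineSubst r c g) ≠ 0) (z : σ → ℂ)
    (hz : ∀ i, r < ‖z i - c‖) : eval z g ≠ 0 := by
  have hr0 : (r : ℂ) ≠ 0 := Complex.ofReal_ne_zero.2 hr.ne'
  have h := hg (fun i => (z i - c) / r) fun i => by
    rw [norm_div, Complex.norm_real, Real.norm_of_nonneg hr.le, lt_div_iff₀ hr, one_mul]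
    exact hz i
  rw [eval_affineSubst] at h
  have hz' : (fun i => (r : ℂ) * ((z i - c) / r) + c) = z := funext fun i => by
    field_simp
    ring
  rwa [hz'] at h

end Transport

/-! ## §3 Part I, Lemma 6.1 (`J = [n]`) for the exterior of an arbitrary disc -/

section Support

/-- **Borcea–Brändén I, Lemma 6.1 (`J = [n]`), `C_i = {|z - c| > r}`.** If `f` has no zeros with all
`|z_i - c| > r` (`r > 0`) then `supp(f)` has a unique maximal element, namely `κ = degVec f ∈ supp(f)`.
Reduction to the unit disc as printed (`z ↦ rz + c` keeps `degVec` and multiplies `a(κ)` by `r^{|κ|}`).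
[cite: BorceaBranden2009, §6.1 Lemma 6.1] -/
theorem BorceaBranden_exteriorBall_support {f : MvPolynomial σ ℂ} (c : ℂ) {r : ℝ} (hr : 0 < r)
    (hs : ∀ z : σ → ℂ, (∀ i, r < ‖z i - c‖) → eval z f ≠ 0) :
    degVec f ∈ f.support ∧ ∀ α ∈ f.support, α ≤ degVec f := by
  refine ⟨?_, fun _ hα => le_degVec (mem_support_iff.1 hα)⟩
  have hr0 : (r : ℂ) ≠ 0 := Complex.ofReal_ne_zero.2 hr.ne'
  have h := degVec_mem_support_of_exteriorDiskStable (exteriorDiskStable_affineSubst c hr hs)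
  rw [degVec_affineSubst hr0, mem_support_iff, coeff_degVec_affineSubst] at h
  exact mem_support_iff.2 (right_ne_zero_of_mul h)

end Support

/-! ## §4 Part II, Theorem 1.2 (b) and Proposition 1.3 (b) for the exterior of an arbitrary disc -/

section Symmetrize

/-- **Borcea–Brändén II, Theorem 1.2 (b) for `C = {|z - c| > r}`** (`r > 0`, any open non-convex circular
domain): if the multi-affine `f` is `Cⁿ`-stable with all variables active, then so is `Sym(f)`.
[cite: BorceaBranden2009II, §1 Thm. 1.2 (b)] -/
theorem symmetrization_exteriorBallStable {f : MvPolynomial σ ℂ} (hact : ∀ i, f.degreeOf i = 1) (c : ℂ)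
    {r : ℝ} (hr : 0 < r) (hs : ∀ z : σ → ℂ, (∀ i, r < ‖z i - c‖) → eval z f ≠ 0) (z : σ → ℂ)
    (hz : ∀ i, r < ‖z i - c‖) : eval z (symmetrization f) ≠ 0 := by
  have hr0 : (r : ℂ) ≠ 0 := Complex.ofReal_ne_zero.2 hr.ne'
  have hF := symmetrization_exteriorDiskStable (f := affineSubst r c f)
    (fun i => by rw [degreeOf_affineSubst hr0, hact i]) (exteriorDiskStable_affineSubst c hr hs)
  rw [symmetrization_affineSubst] at hF
  exact eval_ne_zero_of_exteriorDiskStable_affineSubst c hr hF z hz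

/-- **Borcea–Brändén II, Proposition 1.3 (b) for `C = {|z - c| > r}`** (`r > 0`): if the multi-affine `f` is
`Cⁿ`-stable and depends on both `z_a` and `z_b`, then `θ f + (1-θ) (a b)(f)` (`0 ≤ θ ≤ 1`) is `Cⁿ`-stable.
[cite: BorceaBranden2009II, §1 Prop. 1.3 (b)] -/
theorem partialSymmetrization_exteriorBallStable {f : MvPolynomial σ ℂ} (hf : IsMultiAffine f) {a b : σ}
    (ha : f.degreeOf a = 1) (hb : f.degreeOf b = 1) (c : ℂ) {r : ℝ} (hr : 0 < r)
    (hs : ∀ z : σ → ℂ, (∀ i, r < ‖z i - c‖) → eval z f ≠ 0) {θ : ℝ} (h0 : 0 ≤ θ) (h1 : θ ≤ 1)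
    (z : σ → ℂ) (hz : ∀ i, r < ‖z i - c‖) :
    eval z ((θ : ℂ) • f + (1 - (θ : ℂ)) • rename (Equiv.swap a b) f) ≠ 0 := by
  have hr0 : (r : ℂ) ≠ 0 := Complex.ofReal_ne_zero.2 hr.ne'
  have hF := partialSymmetrization_exteriorDiskStable (hf.affineSubst r c)
    (by rw [degreeOf_affineSubst hr0, ha]) (by rw [degreeOf_affineSubst hr0, hb])
    (exteriorDiskStable_affineSubst c hr hs) h0 h1
  have hlin : (θ : ℂ) • affineSubst r c f + (1 - (θ : ℂ)) • rename (⇑(Equiv.swap a b)) (affineSubst r c f) =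
      affineSubst r c ((θ : ℂ) • f + (1 - (θ : ℂ)) • rename (⇑(Equiv.swap a b)) f) := by
    rw [map_add, map_smul, map_smul, rename_perm_affineSubst]
  simp only [hlin] at hF
  exact eval_ne_zero_of_exteriorDiskStable_affineSubst c hr hF z hz

end Symmetrize

end Literature.Combinatorics.StablePolynomials

end
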